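import Literature.Algebra.Module.FlatTensorOfFlat
import Mathlib.RingTheory.Flat.Localization
import Mathlib.RingTheory.Localization.BaseChange
import HarnessLib

/-!
# Künneth flatness over a field, localized form: `L ⊗_{Oₓ} V` is flat over `O_y` for localizations `Oₓ`, `O_y` of the factors

Layer `Literature/Algebra/Module` (pure commutative algebra, Mathlib only); sequel to `FlatTensorOfFlat` (`Module.Flat.tensorProduct_of_isPushout_field`:
for a pushout `C₀` of `A₀ ← k → B₀` over a field, `L` flat over `C₀` and `V` an `A₀`-module, `L ⊗_{A₀} V` is flat over `B₀`). Here the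
same with the factor rings replaced by LOCALIZATIONS `A₀ → Oₓ`, `B₀ → O_y` through which `L` is an algebra (the situation of the stalks
`𝒪_{X,x}`, `𝒪_{Y,y}`, `𝒪_{X ×_k Y, z}` over affine charts `A₀ = Γ(U)`, `B₀ = Γ(V)`, `C₀ = Γ(U ×_k V)`): for `V` an `Oₓ`-module,
**`L ⊗_{Oₓ} V` is flat over `O_y`** (`Module.Flat.tensorProduct_of_isPushout_field_localization`). Two standard reductions
(Matsumura §7 / Mathlib): `L ⊗_{Oₓ} V = L ⊗_{A₀} V` because `Oₓ ⊗_{A₀} V = V` for a localization `Oₓ` of `A₀` and an `Oₓ`-module `V`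
(`isLocalizedModule_id`, `IsLocalizedModule.isBaseChange`, `cancelBaseChange`), and flatness over the localization `O_y` of `B₀` is flatness
over `B₀` (`Module.flat_iff_of_isLocalization`). Everything is proved; 0 named facts; no instances.

## References

* H. Matsumura, *Commutative Ring Theory* (1987), §7 (p. 46) Transitivity / Change of coefficient ring; Thm. 4.4–4.5 (localization is flat). [Matsumura1987]
* The Stacks Project, Tag 00HI, Tag 02C1 (flatness and localization). [StacksProject]
-/

open scoped TensorProduct

universe u

namespace Literature.Algebra.Module

section Localization

section Cancel

variable (A₀ Ox L : Type u) [CommRing A₀] [CommRing Ox] [CommRing L] [Algebra A₀ Ox] (S : Submonoid A₀) [IsLocalization S Ox]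
  [Algebra A₀ L] [Algebra Ox L] [IsScalarTower A₀ Ox L]
  (V : Type u) [AddCommGroup V] [Module Ox V] [Module A₀ V] [IsScalarTower A₀ Ox V]

include S in
/-- `L ⊗_{Oₓ} V ≃ L ⊗_{A₀} V` (`L`-linearly) when `Oₓ` is a localization of `A₀` and `V` is an `Oₓ`-module: `Oₓ ⊗_{A₀} V ≅ V`
(`isLocalizedModule_id`) and `L ⊗_{Oₓ} (Oₓ ⊗_{A₀} V) ≅ L ⊗_{A₀} V` (`cancelBaseChange`). [cite: Matsumura1987, Thm. 4.4–4.5 (localization, p. 22–23)] -/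
theorem nonempty_tensorProduct_localization_linearEquiv : Nonempty (L ⊗[Ox] V ≃ₗ[L] L ⊗[A₀] V) := by
  haveI := isLocalizedModule_id S V Ox
  let e : Ox ⊗[A₀] V ≃ₗ[Ox] V := (IsLocalizedModule.isBaseChange S Ox (LinearMap.id : V →ₗ[A₀] V)).equiv
  exact ⟨(TensorProduct.AlgebraTensorModule.congr (LinearEquiv.refl L L) e).symm ≪≫ₗ
    TensorProduct.AlgebraTensorModule.cancelBaseChange A₀ Ox L L V⟩

end Cancel

variable (k : Type u) [Field k] (A₀ B₀ C₀ : Type u) [CommRing A₀] [CommRing B₀] [CommRing C₀]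
  [Algebra k A₀] [Algebra k B₀] [Algebra k C₀] [Algebra A₀ C₀] [Algebra B₀ C₀]
  [IsScalarTower k A₀ C₀] [IsScalarTower k B₀ C₀] [Algebra.IsPushout k B₀ A₀ C₀]
  (Ox Oy L : Type u) [CommRing Ox] [CommRing Oy] [CommRing L]
  [Algebra A₀ Ox] (S : Submonoid A₀) [IsLocalization S Ox] [Algebra B₀ Oy] (T : Submonoid B₀) [IsLocalization T Oy]
  [Algebra C₀ L] [Algebra A₀ L] [Algebra B₀ L] [IsScalarTower A₀ C₀ L] [IsScalarTower B₀ C₀ L]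
  [Algebra Ox L] [IsScalarTower A₀ Ox L] [Algebra Oy L] [IsScalarTower B₀ Oy L]
  [SMulCommClass Ox B₀ L] [SMulCommClass Ox Oy L]
  (V : Type u) [AddCommGroup V] [Module Ox V] [Module A₀ V] [IsScalarTower A₀ Ox V]

include k C₀ S T

/-- **Künneth flatness over a field, localized form**: `k` a field, `C₀` a pushout of `A₀ ← k → B₀`, `Oₓ` a localization of `A₀`, `O_y`
a localization of `B₀`, `L` a `C₀`-algebra FLAT over `C₀` which is an `Oₓ`- and `O_y`-algebra compatibly, `V` an `Oₓ`-module: **`L ⊗_{Oₓ} V`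
is flat over `O_y`** (scalars through `L`). With `A₀ = Γ(U)`, `B₀ = Γ(V')`, `C₀ = Γ(U ×_k V')`, `Oₓ = 𝒪_{X,x}`, `O_y = 𝒪_{Y,y}`,
`L = 𝒪_{X ×_k Y, z}`, `V = G_x`: `(p^*G)_z = L ⊗_{𝒪_{X,x}} G_x` is flat over `𝒪_{Y,y}` — the Tor-independence of the projections over a field.
[cite: Matsumura1987, §7 Transitivity (1), Change of coefficient ring (1) (p. 46) and Thm. 4.4–4.5] -/
theorem _root_.Module.Flat.tensorProduct_of_isPushout_field_localization [Module.Flat C₀ L] : Module.Flat Oy (L ⊗[Ox] V) := by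
  haveI : Module.Flat B₀ (L ⊗[A₀] V) := Module.Flat.tensorProduct_of_isPushout_field k A₀ B₀ C₀ L V
  obtain ⟨e⟩ := nonempty_tensorProduct_localization_linearEquiv A₀ Ox L S V
  haveI : Module.Flat B₀ (L ⊗[Ox] V) := Module.Flat.of_linearEquiv (e.restrictScalars B₀)
  exact (Module.flat_iff_of_isLocalization Oy T (L ⊗[Ox] V)).mpr this

end Localization

end Literature.Algebra.Module
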